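import Summits.AnomalousDissipation.AnomalousDissipation.Theorems.MomentParityCubicParityLoudBalancedMenuDesign
import Literature.Analysis.FunctionSpaces.TorusFourierSynthesis
import Literature.Analysis.FunctionSpaces.TorusHNegOnePairing

/-!
# Stub S5 `stub_balancedMenu` of the line `farkas-split-menu`: the two-dial menu of 1-stationary atom clouds

Proof of the registered stub `stub_balancedMenu` of crux `MomentParity.CubicParityLoud`
(stmt-AnomalousDissipation-11465), line `farkas-split-menu`. For every smooth divergence-free
mean-zero force `f ≠ 0`: a FORCED MODE `p₀ ≠ 0` with `f̂(p₀) ≠ 0` (Fourier uniqueness, zero mean);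
the design of `…BalancedMenuDesign` (mean flow on `±p₀`, stress packets, chiral sea) with its
constants `H₀, H₁, C`; then with `W = ‖f̂(p₀)‖²` the menu constants
`E = 10W + C`, `ε = δ = W/2`, `ν₀ = min 1 (min (2W/(16π²(Z_m + C + 1))) (2πW/M))`,
`Z_m = 2|p₀|²W`, `M = W/2 + |H₀| + |H₁|`; for `ν ∈ (0, ν₀)` the shell radius `K = ⌈ν⁻¹⌉` and the
threshold `N₀ = max K (max ⌈|p₀|²⌉ 2)`; for `N ≥ N₀` and dials `|a|, |b| ≤ δ` the sea amplitudes
`A₊² = (Σ - Δ)/2`, `A₋² = (Σ + Δ)/2`, `Σ = (2W - a - 4π²ν(Z_m + Z_P))/(16π²νK²)`,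
`Δ = (b - H₀ - νH₁)/(32π³νK³)`, which make the ENERGY DRIFT `a` and the HELICITY DRIFT `b`
(`|Δ| ≤ Σ` by the choice of `ν₀`), with energy `≤ E` and dissipation `2W - a ≥ 2ε`.
-/

noncomputable section

namespace Summit.AnomalousDissipation.AnomalousDissipation.Theorems.MomentParityCubicParityLoud

open MeasureTheory Filter UnitAddTorus
open scoped InnerProductSpace RealInnerProductSpace ENNReal
open Literature.Analysis.FunctionSpaces Literature.Analysis.FluidPDE
open Summit.AnomalousDissipation.AnomalousDissipation.Theses.MomentParity
open Summit.AnomalousDissipation.AnomalousDissipation.Theorems.CubicParityLoud.Negative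

set_option linter.dupNamespace false

/-- **A non-zero smooth field has a non-zero Fourier coefficient at a non-zero frequency when it has
zero mean** (Fourier uniqueness for continuous functions; `f̂(0) = ∫ f = 0`). [folklore] -/
theorem exists_forcedMode {f : T3 → R3} (hf : Torus.IsSmooth f) (hmean : Torus.HasZeroMean f) (hf0 : f ≠ 0) :
    ∃ p₀ : Fin 3 → ℤ, p₀ ≠ 0 ∧ mFourierCoeff (EuclideanSpace.complexify ∘ f) p₀ ≠ 0 := by
  obtain ⟨p₀, hp₀⟩ : ∃ p₀ : Fin 3 → ℤ, mFourierCoeff (EuclideanSpace.complexify ∘ f) p₀ ≠ 0 := by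
    by_contra h
    push Not at h
    apply hf0
    have hz := Torus.eq_zero_of_forall_mFourierCoeff_eq_zero
      (EuclideanSpace.continuous_complexify.comp hf.continuous) h
    funext x
    apply EuclideanSpace.complexify_injective
    have := congrFun hz x
    simp only [Function.comp_apply, Pi.zero_apply] at this
    rw [this, Pi.zero_apply, map_zero]
  refine ⟨p₀, ?_, hp₀⟩
  rintro rfl
  exact hp₀ (Torus.mFourierCoeff_complexify_zero_of_hasZeroMean hf.integrable hmean)

/-- **Stub S5 `stub_balancedMenu`: THE TWO-DIAL MENU OF 1-STATIONARY ATOM CLOUDS.** For every smooth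
divergence-free mean-zero force `f ≠ 0` there are `E`, `ε > 0`, `ν₀ > 0`, `δ > 0` such that for all
`ν ∈ (0, ν₀)`, all `N ≥ N₀(ν)` and every dial `(a, b) ∈ [−δ, δ]²` there is a probability law on `H`
carried by level-`N` fields, with finite third moments, all of whose LINEAR rows vanish, with energy
drift `a`, helicity drift `b`, energy `≤ E` and dissipation `≥ 2ε`. [folklore] -/
theorem stub_balancedMenu :
    ∀ f : T3 → R3, Torus.IsSmooth f → Torus.IsDivFree f → Torus.HasZeroMean f → f ≠ 0 →
      ∃ E ε ν₀ δ : ℝ, 0 < ε ∧ 0 < ν₀ ∧ 0 < δ ∧ ∀ ν : ℝ, 0 < ν → ν < ν₀ →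
        ∃ N₀ : ℕ, ∀ N : ℕ, N₀ ≤ N → ∀ a b : ℝ, |a| ≤ δ → |b| ≤ δ → ∃ μ : Measure H3,
          IsProbabilityMeasure μ ∧ (∀ᵐ u ∂μ, IsLevel N u) ∧
          Integrable (fun u : H3 => ‖u‖ ^ 3) μ ∧
          (∀ g : T3 → R3, IsBandTest N g →
              Integrable (fun u : H3 => Torus.nsGeneratorPairing ν f u g) μ ∧
                ∫ u, Torus.nsGeneratorPairing ν f u g ∂μ = 0) ∧
          (Integrable (fun u : H3 => Torus.nsGeneratorPairing ν f u
              (Torus.fourierTruncate N ((u : L2T3) : T3 → R3))) μ ∧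
            ∫ u, Torus.nsGeneratorPairing ν f u
              (Torus.fourierTruncate N ((u : L2T3) : T3 → R3)) ∂μ = a) ∧
          (Integrable (fun u : H3 => Torus.nsGeneratorPairing ν f u
              (BDSV.curl (Torus.fourierTruncate N ((u : L2T3) : T3 → R3)))) μ ∧
            ∫ u, Torus.nsGeneratorPairing ν f u
              (BDSV.curl (Torus.fourierTruncate N ((u : L2T3) : T3 → R3))) ∂μ = b) ∧
          Torus.ensembleEnergy μ ≤ E ∧ 2 * ε ≤ Torus.ensembleDissipation ν μ := by
  intro f hf hdiv hmean hf0
  -- (0) the forced mode and the design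
  obtain ⟨p₀, hp₀0, hp₀⟩ := exists_forcedMode hf hmean hf0
  obtain ⟨H₀, H₁, C, hC0, hdesign⟩ := balancedMenu_design_aux hf hdiv hp₀0
  set W : ℝ := ‖mFourierCoeff (EuclideanSpace.complexify ∘ f) p₀‖ ^ 2 with hW
  have hWpos : 0 < W := by rw [hW]; exact pow_pos (norm_pos_iff.2 hp₀) 2
  set Zm : ℝ := 2 * (Torus.freqNormSq p₀ * W) with hZm
  have hZm0 : 0 ≤ Zm := by rw [hZm]; exact mul_nonneg (by norm_num) (mul_nonneg (Torus.freqNormSq_nonneg p₀) hWpos.le)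
  clear_value W Zm
  set M : ℝ := W / 2 + |H₀| + |H₁| with hM
  have hMpos : 0 < M := by rw [hM]; positivity
  have hπ : 0 < Real.pi := Real.pi_pos
  have hden : 0 < 16 * Real.pi ^ 2 * (Zm + C + 1) := by positivity
  -- (1) the constants
  refine ⟨10 * W + C, W / 2, min 1 (min (2 * W / (16 * Real.pi ^ 2 * (Zm + C + 1))) (2 * Real.pi * W / M)),
    W / 2, by positivity, lt_min one_pos (lt_min (by positivity) (by positivity)), by positivity,
    fun ν hν hνν₀ => ?_⟩
  have hν1 : ν ≤ 1 := hνν₀.le.trans (min_le_left _ _)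
  have hνA : ν ≤ 2 * W / (16 * Real.pi ^ 2 * (Zm + C + 1)) :=
    hνν₀.le.trans ((min_le_right _ _).trans (min_le_left _ _))
  have hνB : ν ≤ 2 * Real.pi * W / M := hνν₀.le.trans ((min_le_right _ _).trans (min_le_right _ _))
  -- (2) the shell radius and the threshold
  set K : ℕ := ⌈ν⁻¹⌉₊ with hKdef
  have hK1 : 1 ≤ K := Nat.one_le_ceil_iff.2 (inv_pos.2 hν)
  have hKν : ν⁻¹ ≤ (K : ℝ) := Nat.le_ceil _
  have hKpos : (0 : ℝ) < K := by exact_mod_cast hK1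
  have hνK : 1 ≤ ν * (K : ℝ) := by
    have := mul_le_mul_of_nonneg_left hKν hν.le
    rwa [mul_inv_cancel₀ hν.ne'] at this
  have hνK2 : 1 ≤ ν * (K : ℝ) ^ 2 := by
    have h1 : (1 : ℝ) ≤ K := by exact_mod_cast hK1
    nlinarith only [hνK, h1, hν.le]
  clear_value K
  refine ⟨max K (max ⌈Torus.freqNormSq p₀⌉₊ 2), fun N hN a b ha hb => ?_⟩
  have hKN : K ≤ N := le_trans (le_max_left _ _) hN
  have hN2 : 2 ≤ N := le_trans (le_trans (le_max_right _ _) (le_max_right _ _)) hN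
  have hp₀N : Torus.freqNormSq p₀ ≤ (N : ℝ) ^ 2 := by
    have h1 : ⌈Torus.freqNormSq p₀⌉₊ ≤ N := le_trans (le_trans (le_max_left _ _) (le_max_right _ _)) hN
    have h2 : Torus.freqNormSq p₀ ≤ N := (Nat.le_ceil _).trans (by exact_mod_cast h1)
    have h3 : (1 : ℝ) ≤ N := by exact_mod_cast le_trans (by norm_num) hN2
    nlinarith only [h2, h3, Torus.freqNormSq_nonneg p₀]
  obtain ⟨ZP, EP, hEP0, hEPZP, hZPC, hall⟩ := hdesign N K ν hν.le hν1 hK1 hKN hN2 hp₀N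
  have hZP0 : 0 ≤ ZP := hEP0.trans hEPZP
  -- (3) the dials
  have habs : -(W / 2) ≤ a ∧ a ≤ W / 2 := abs_le.1 ha
  have hbabs : |b| ≤ W / 2 := hb
  set Sg : ℝ := (2 * W - a - 4 * Real.pi ^ 2 * ν * (Zm + ZP)) / (16 * Real.pi ^ 2 * ν * (K : ℝ) ^ 2) with hSg
  set Dl : ℝ := (b - H₀ - ν * H₁) / (32 * Real.pi ^ 3 * ν * (K : ℝ) ^ 3) with hDl
  have hD1 : 0 < 16 * Real.pi ^ 2 * ν * (K : ℝ) ^ 2 := by positivity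
  have hD2 : 0 < 32 * Real.pi ^ 3 * ν * (K : ℝ) ^ 3 := by positivity
  -- `Σ ≥ W / (16π²νK²)`
  have hνZ : 4 * Real.pi ^ 2 * ν * (Zm + ZP) ≤ W / 2 := by
    have h1 : ν * (16 * Real.pi ^ 2 * (Zm + C + 1)) ≤ 2 * W := (le_div_iff₀ hden).1 hνA
    have h2 : Real.pi ^ 2 * (ν * ZP) ≤ Real.pi ^ 2 * (ν * C) :=
      mul_le_mul_of_nonneg_left (mul_le_mul_of_nonneg_left hZPC hν.le) (sq_nonneg _)
    have h3 : 0 ≤ Real.pi ^ 2 * ν := mul_nonneg (sq_nonneg _) hν.le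
    nlinarith only [h1, h2, h3]
  have hSgl : W / (16 * Real.pi ^ 2 * ν * (K : ℝ) ^ 2) ≤ Sg := by
    rw [hSg]
    exact div_le_div_of_nonneg_right (by linarith) hD1.le
  have hSgu : Sg ≤ (5 * W / 2) / (16 * Real.pi ^ 2 * ν * (K : ℝ) ^ 2) := by
    rw [hSg]
    refine div_le_div_of_nonneg_right ?_ hD1.le
    have h0 : 0 ≤ 4 * Real.pi ^ 2 * ν * (Zm + ZP) := by positivity
    linarith only [h0, habs.1]
  have hSgW : Sg ≤ 2 * W := by
    refine hSgu.trans ?_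
    rw [div_le_iff₀ hD1]
    have hπ2 : (2 : ℝ) ^ 2 ≤ Real.pi ^ 2 := pow_le_pow_left₀ (by norm_num) Real.two_le_pi 2
    have h64 : (64 : ℝ) ≤ 16 * Real.pi ^ 2 * ν * (K : ℝ) ^ 2 := by nlinarith only [hπ2, hνK2]
    nlinarith only [h64, hWpos]
  -- `|Δ| ≤ M / (32π³νK³) ≤ W / (16π²νK²)`
  have hDlu : |Dl| ≤ M / (32 * Real.pi ^ 3 * ν * (K : ℝ) ^ 3) := by
    rw [hDl, abs_div, abs_of_pos hD2]
    refine div_le_div_of_nonneg_right ?_ hD2.le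
    calc |b - H₀ - ν * H₁| ≤ |b| + |H₀| + |ν * H₁| := by
          have h1 := abs_sub (b - H₀) (ν * H₁)
          have h2 := abs_sub b H₀
          linarith only [h1, h2]
      _ ≤ W / 2 + |H₀| + |H₁| := by
          rw [abs_mul, abs_of_pos hν]
          linarith only [hbabs, mul_le_of_le_one_left (abs_nonneg H₁) hν1]
  have hcomp : M / (32 * Real.pi ^ 3 * ν * (K : ℝ) ^ 3) ≤ W / (16 * Real.pi ^ 2 * ν * (K : ℝ) ^ 2) := by
    rw [div_le_div_iff₀ hD2 hD1]
    -- `M · 16π²νK² ≤ W · 32π³νK³` from `M ≤ 2π K W` (`K ≥ ν⁻¹ ≥ M/(2πW)`)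
    have hMK : M ≤ 2 * Real.pi * W * K := by
      have h1 : ν * M ≤ 2 * Real.pi * W := (le_div_iff₀ hMpos).1 hνB
      have h2 : M ≤ 2 * Real.pi * W * ν⁻¹ := by
        rw [le_mul_inv_iff₀ hν]; linarith
      exact h2.trans (mul_le_mul_of_nonneg_left hKν (by positivity))
    have h3 : 0 ≤ 16 * Real.pi ^ 2 * ν * (K : ℝ) ^ 2 := hD1.le
    nlinarith only [mul_le_mul_of_nonneg_right hMK h3]
  have hSD : |Dl| ≤ Sg := hDlu.trans (hcomp.trans hSgl)
  have hSD' := abs_le.1 hSD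
  set Ap : ℝ := Real.sqrt ((Sg - Dl) / 2) with hAp
  set An : ℝ := Real.sqrt ((Sg + Dl) / 2) with hAn
  have hAp2 : Ap ^ 2 = (Sg - Dl) / 2 := by rw [hAp]; exact Real.sq_sqrt (by linarith)
  have hAn2 : An ^ 2 = (Sg + Dl) / 2 := by rw [hAn]; exact Real.sq_sqrt (by linarith)
  clear_value Ap An
  -- (4) the law
  obtain ⟨μ, hP, hL, h3, hrows, ⟨hEi, hEv⟩, ⟨hHi, hHv⟩, hEn, hD⟩ := hall Ap An
  have hsum : 4 * (K : ℝ) ^ 2 * Ap ^ 2 + 4 * (K : ℝ) ^ 2 * An ^ 2 = 4 * (K : ℝ) ^ 2 * Sg := by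
    rw [hAp2, hAn2]; ring
  have hkey : ν * (4 * Real.pi ^ 2 * (4 * (K : ℝ) ^ 2 * Sg)) = 2 * W - a - 4 * Real.pi ^ 2 * ν * (Zm + ZP) := by
    rw [hSg]; field_simp; ring
  have hdiss : ν * (4 * Real.pi ^ 2 * (Zm + (ZP + (4 * (K : ℝ) ^ 2 * Ap ^ 2 + 4 * (K : ℝ) ^ 2 * An ^ 2)))) = 2 * W - a := by
    rw [hsum]; linear_combination hkey
  have hhel : -(1 : ℝ) * (32 * Real.pi ^ 3 * (K : ℝ) ^ 3 * Ap ^ 2) + -(-1 : ℝ) * (32 * Real.pi ^ 3 * (K : ℝ) ^ 3 * An ^ 2) =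
      32 * Real.pi ^ 3 * (K : ℝ) ^ 3 * Dl := by
    rw [hAp2, hAn2]; ring
  have hDl' : ν * (32 * Real.pi ^ 3 * (K : ℝ) ^ 3 * Dl) = b - H₀ - ν * H₁ := by
    rw [hDl]; field_simp
  refine ⟨μ, hP, hL, h3, hrows, ⟨hEi, ?_⟩, ⟨hHi, ?_⟩, ?_, ?_⟩
  · -- energy drift `= a`
    rw [hEv, hdiss]; ring
  · -- helicity drift `= b`
    rw [hHv, hhel]; linear_combination hDl'
  · -- energy `≤ E`
    rw [hEn]
    have h4 : 4 * Ap ^ 2 + 4 * An ^ 2 = 4 * Sg := by rw [hAp2, hAn2]; ring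
    rw [h4]
    linarith only [hEPZP, hZPC, hSgW]
  · -- dissipation `≥ 2ε`
    rw [hD, hdiss]
    linarith only [habs.2, hWpos]

end Summit.AnomalousDissipation.AnomalousDissipation.Theorems.MomentParityCubicParityLoud

end
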